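import Summits.BirchSwinnertonDyer.BirchSwinnertonDyer.Theorems.ClassRecordThreeEulerHalvesAtThreeCartanCoverPrintClausesUnitIndex
import Summits.BirchSwinnertonDyer.BirchSwinnertonDyer.Theorems.ClassRecordThreeEulerHalvesAtThreeCartanCoverPrintClausesDivision
import Literature.Geometry.Kaehler.ComplexTorusQuaternionUnitGroupFinitelyGeneratedSplit
import Literature.NumberTheory.Automorphic.QuaternionAlgebraStructure
import HarnessLib

/-!
# Crux NUM `CartanOnePlaceDegreeLawAtThree` (item 24801), line `lattice` — the print clauses IV: **`ι(O¹)` IS FINITELY GENERATED for EVERY order `O` of EVERY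
# quaternion algebra `B` over `ℚ` with a real embedding `ι : B →ₐ[ℚ] M₂(ℝ)`**; hence clause (SIGᶜ)(i) of `parabolicCochain_free_and_modLift` HOLDS AS STATED

Seat `bsd-stepL-tam3-p1` g29 (LEAD of crux 24801; `--supports stmt-BirchSwinnertonDyer-24801 --as helper`). Sequel of `…PrintClausesDivision` (§2: (SIGᶜ)(i) ⇐
`Group.FG (normOneUnits ι hO)`) and `…PrintClausesUnitIndex` (change of presentation; commensurability of the norm-one groups of two orders). INPUT, by name:
Bergeron's family `Γ_{a,b} = ρ(𝔬¹) ≤ SL₂(ℝ)` of the tree's `Literature/Geometry/Kaehler/ComplexTorusQuaternionUnitGroup*` — `QuaternionType.fg_unitGroup` (Thm. 2.3 (2):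
`Γ_{a,b}` is finitely generated for EVERY `a ≠ 0 < b`: cocompactness if `(a,b)_ℚ` is a skew field, arithmeticity + `SL(2,ℤ) = ⟨S,T⟩` if it splits), its junction
`map_toGL_unitGroup_eq_normOneUnits` (`Γ_{a,b} = normOneUnits (rhoQ) 𝔬`), `exists_algEquiv_eq_rho`, the tree's Skolem–Noether `Matrix.exists_units_forall_algHom_eq_conj`,
and `IsQuaternionAlgebra.exists_algEquiv_quaternionAlgebra` (`B ≃ ℍ[ℚ,a₀,b₀]`).

* §1 (private transport, after `ComplexTorusQuaternionUnitGroupCommensurable` §1, re-derived because that module has no hub olean in this closure): every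
  `g : ℍ[ℚ,a,b] →ₐ[ℚ] M₂(ℝ)` extends to `ψ : ℍ[ℝ,a,b] →ₐ[ℝ] M₂(ℝ)`; for `a ≠ 0 < b` it is `h ρ h⁻¹` (Skolem–Noether).
* §2 parameters: `nonempty_algEquiv_rescale` (`ℍ[ℚ,a,b] ≃ₐ ℍ[ℚ,a c², b d²]`), `nonempty_algEquiv_swap` (`ℍ[ℚ,a,b] ≃ₐ ℍ[ℚ,b,a]`), `false_of_algHom_real_of_neg` (no `ℚ`-algebra
  map `ℍ[ℚ,a,b] → M₂(ℝ)` when `a, b < 0`: its real extension would be an isomorphism from a division algebra onto `M₂(ℝ)`), hence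
  **`exists_int_algEquiv_of_algHom_real`**: a quaternion algebra `B` over `ℚ` with a `ℚ`-algebra map `B → M₂(ℝ)` is `≃ₐ[ℚ] ℍ[ℚ,a,b]` for INTEGERS `a ≠ 0 < b`.
* §3 **`fg_normOneUnits`**: `(normOneUnits ι hO).FG` for every order `O` of every quaternion algebra `B` over `ℚ` and every injective `ι : B →ₐ[ℚ] M₂(ℝ)` — transport
  `B ≃ ℍ[ℚ,a,b]` (§2, `normOneUnits_comp_algEquiv`), Skolem–Noether (§1, `normOneUnits_eq_conjAct_smul`), commensurability of the unit groups of the transported order and of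
  `𝔬 = ℤ⟨1,i,j,ij⟩` (`commensurable_normOneUnits`), `fg_unitGroup` and `subgroupFG_of_commensurable`. So `ι(O¹)` is a finitely generated Fuchsian group (Shimura §9.2 p. 246
  «always a Fuchsian group of the first kind»; Prop. 1.31∕8.6) — **and clause (SIGᶜ)(i) HOLDS AS STATED**: `sigBasisClause` = the first conjunct of
  `Literature.NumberTheory.Automorphic.parabolicCochain_free_and_modLift` for all `(B, O, ι)`, PROVED.

Honest: clause (SIGᶜ)(ii) (the lift of torsion- and parabolic-null mod-`n` cochains: Armstrong ∕ the Fuchsian presentation) and (ESᶜ) remain print; the cite stub of the line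
still cites (SIGᶜ) WHOLE (the glue consumes the named fact whole). Nothing about NUM or any curve is proved; BSD is proved for no curve.
[cite: Bergeron2016, §2.2 Thm. 2.3 (2) p. 36, §2.2.3 Lemma 2.7 p. 41] [cite: ShimuraIATAF1971, §9.2 p. 246 and Prop. 1.31] [cite: VignerasLNM800, Ch. IV §1 Thm. 1.1]
[cite: Voight2021, §7.7 Main Thm. 7.7.1]
-/

set_option linter.dupNamespace false
set_option autoImplicit false

noncomputable section

open scoped MatrixGroups Pointwise Quaternion
open Function Set

namespace Summit.BirchSwinnertonDyer.BirchSwinnertonDyer.Theorems.CartanCover.PrintClauses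

open Literature.NumberTheory.Automorphic
open Literature.Geometry.Kaehler.ComplexTorus.QuaternionType

/-! ## §1 Real extension and Skolem–Noether for `g : ℍ[ℚ,a,b] →ₐ[ℚ] M₂(ℝ)` -/

section SkolemNoether

variable {a b : ℤ}

/-- A rational scalar of the `ℚ`-algebra `M₂(ℝ)` is the real scalar matrix.
-- adapted from Literature/Geometry/Kaehler/ComplexTorusQuaternionUnitGroupCommensurable.lean §1 (no hub olean for that module in this closure) [folklore] -/
private theorem algebraMap_rat_matrix' (q : ℚ) :
    algebraMap ℚ (Matrix (Fin 2) (Fin 2) ℝ) q = algebraMap ℝ (Matrix (Fin 2) (Fin 2) ℝ) (q : ℝ) := by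
  rw [Algebra.algebraMap_eq_smul_one, Algebra.algebraMap_eq_smul_one, Rat.cast_smul_eq_qsmul]

/-- A quaternion in the basis `1, i, j, ij`. [folklore] -/
private theorem eq_basis_sum'' {R : Type*} [CommRing R] (x : ℍ[R,(a : R),(b : R)]) :
    x = algebraMap R _ x.re + x.imI • (⟨0, 1, 0, 0⟩ : ℍ[R,(a : R),(b : R)]) +
      x.imJ • (⟨0, 0, 1, 0⟩ : ℍ[R,(a : R),(b : R)]) +
      x.imK • ((⟨0, 1, 0, 0⟩ : ℍ[R,(a : R),(b : R)]) * ⟨0, 0, 1, 0⟩) := by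
  ext <;> simp

/-- **Base change of `g : ℍ[ℚ,a,b] →ₐ[ℚ] M₂(ℝ)` to `ψ : ℍ[ℝ,a,b] →ₐ[ℝ] M₂(ℝ)`** with `ψ (castQ x) = g x`.
-- adapted from Literature/Geometry/Kaehler/ComplexTorusQuaternionUnitGroupCommensurable.lean `exists_algHom_extension_real`
[cite: Bergeron2016, §2.2 proof of Thm. 2.3 p. 37] -/
private theorem exists_algHom_extension_real' (g : ℍ[ℚ,(a : ℚ),(b : ℚ)] →ₐ[ℚ] Matrix (Fin 2) (Fin 2) ℝ) :
    ∃ ψ : ℍ[ℝ,(a : ℝ),(b : ℝ)] →ₐ[ℝ] Matrix (Fin 2) (Fin 2) ℝ, ∀ x, ψ (castQ a b x) = g x := by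
  set I : ℍ[ℚ,(a : ℚ),(b : ℚ)] := ⟨0, 1, 0, 0⟩ with hI
  set J : ℍ[ℚ,(a : ℚ),(b : ℚ)] := ⟨0, 0, 1, 0⟩ with hJ
  have hII : I * I = algebraMap ℚ _ (a : ℚ) := by
    rw [hI]; ext <;> simp
  have hJJ : J * J = algebraMap ℚ _ (b : ℚ) := by
    rw [hJ]; ext <;> simp
  have hJI : J * I = -(I * J) := by
    rw [hI, hJ]; ext <;> simp
  have hEi : g I * g I = ((a : ℤ) : ℝ) • (1 : Matrix (Fin 2) (Fin 2) ℝ) + (0 : ℝ) • g I := by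
    rw [zero_smul, add_zero, ← map_mul, hII, AlgHom.commutes, algebraMap_rat_matrix', Algebra.algebraMap_eq_smul_one,
      Rat.cast_intCast]
  have hEj : g J * g J = ((b : ℤ) : ℝ) • (1 : Matrix (Fin 2) (Fin 2) ℝ) := by
    rw [← map_mul, hJJ, AlgHom.commutes, algebraMap_rat_matrix', Algebra.algebraMap_eq_smul_one, Rat.cast_intCast]
  have hEji : g J * g I = (0 : ℝ) • g J - g I * g J := by
    rw [zero_smul, zero_sub, ← map_mul, ← map_mul, hJI, map_neg]
  let q : QuaternionAlgebra.Basis (Matrix (Fin 2) (Fin 2) ℝ) ((a : ℤ) : ℝ) 0 ((b : ℤ) : ℝ) :=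
    { i := g I, j := g J, k := g I * g J,
      i_mul_i := hEi, j_mul_j := hEj, i_mul_j := rfl, j_mul_i := hEji }
  refine ⟨q.liftHom, fun x => ?_⟩
  rw [QuaternionAlgebra.Basis.liftHom_apply, QuaternionAlgebra.Basis.lift]
  conv_rhs => rw [eq_basis_sum'' x]
  simp only [map_add, map_mul, AlgHom.commutes, map_smul, castQ_re, castQ_imI, castQ_imJ, castQ_imK]
  rw [algebraMap_rat_matrix', ← Rat.cast_smul_eq_qsmul ℝ x.imI, ← Rat.cast_smul_eq_qsmul ℝ x.imJ,
    ← Rat.cast_smul_eq_qsmul ℝ x.imK]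

/-- **Skolem–Noether for `g : ℍ[ℚ,a,b] →ₐ[ℚ] M₂(ℝ)`, `a ≠ 0 < b`: `g = h ρ h⁻¹`** for some `h ∈ GL₂(ℝ)`.
-- adapted from Literature/Geometry/Kaehler/ComplexTorusQuaternionUnitGroupCommensurable.lean `exists_units_forall_eq_conj`
[cite: Voight2021, §7.7 Main Thm. 7.7.1 and Cor. 7.7.4] [cite: Bergeron2016, §2.2 proof of Thm. 2.3 p. 37] -/
private theorem exists_units_forall_eq_conj' (ha : a ≠ 0) (hb : 0 < b) (g : ℍ[ℚ,(a : ℚ),(b : ℚ)] →ₐ[ℚ] Matrix (Fin 2) (Fin 2) ℝ) :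
    ∃ h : GL (Fin 2) ℝ, ∀ x : ℍ[ℚ,(a : ℚ),(b : ℚ)],
      g x = (h : Matrix (Fin 2) (Fin 2) ℝ) * rhoQ hb.le x * ((h⁻¹ : GL (Fin 2) ℝ) : Matrix (Fin 2) (Fin 2) ℝ) := by
  obtain ⟨ψ, hψ⟩ := exists_algHom_extension_real' (a := a) (b := b) g
  obtain ⟨ρ', hρ'⟩ := exists_algEquiv_eq_rho ha hb
  obtain ⟨u, hu⟩ := Literature.RingTheory.CentralSimple.Matrix.exists_units_forall_algHom_eq_conj (K := ℝ)
    (ψ.comp (ρ'.symm : Matrix (Fin 2) (Fin 2) ℝ →ₐ[ℝ] ℍ[ℝ,(a : ℝ),(b : ℝ)]))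
  refine ⟨u, fun x => ?_⟩
  have h1 : ψ (castQ a b x) = (ψ.comp (ρ'.symm : Matrix (Fin 2) (Fin 2) ℝ →ₐ[ℝ] ℍ[ℝ,(a : ℝ),(b : ℝ)]))
      (rho a b hb.le (castQ a b x)) := by
    rw [AlgHom.comp_apply]
    change ψ (castQ a b x) = ψ (ρ'.symm (rho a b hb.le (castQ a b x)))
    rw [← hρ', AlgEquiv.symm_apply_apply]
  rw [← hψ, h1, hu, rhoQ_apply]

end SkolemNoether

/-! ## §2 Parameters: rescaling, swapping, and indefiniteness from a real embedding -/

section Parameters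

/-- **Rescaling the parameters by squares**: `ℍ[ℚ,a,b] ≃ₐ[ℚ] ℍ[ℚ,a',b']` whenever `a' = a c²`, `b' = b d²` with `c, d ≠ 0` (`i ↦ c⁻¹ i'`, `j ↦ d⁻¹ j'`).
[cite: VignerasLNM800, Ch. I §1 p. 1–2] -/
theorem nonempty_algEquiv_rescale (a b a' b' c d : ℚ) (hc : c ≠ 0) (hd : d ≠ 0) (ha' : a' = a * c ^ 2) (hb' : b' = b * d ^ 2) :
    Nonempty (ℍ[ℚ,a,b] ≃ₐ[ℚ] ℍ[ℚ,a',b']) := by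
  -- the basis `(c⁻¹ i', d⁻¹ j')` of type `(a, b)` in `ℍ[ℚ,a',b']`
  let q : QuaternionAlgebra.Basis ℍ[ℚ,a',b'] a 0 b :=
    { i := ⟨0, c⁻¹, 0, 0⟩, j := ⟨0, 0, d⁻¹, 0⟩, k := ⟨0, 0, 0, c⁻¹ * d⁻¹⟩,
      i_mul_i := by
        ext <;> simp [ha']; field_simp
      j_mul_j := by
        ext <;> simp [hb']; field_simp
      i_mul_j := by ext <;> simp
      j_mul_i := by ext <;> simp [mul_comm] }
  -- the basis `(c i, d j)` of type `(a', b')` in `ℍ[ℚ,a,b]`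
  let q' : QuaternionAlgebra.Basis ℍ[ℚ,a,b] a' 0 b' :=
    { i := ⟨0, c, 0, 0⟩, j := ⟨0, 0, d, 0⟩, k := ⟨0, 0, 0, c * d⟩,
      i_mul_i := by
        ext <;> simp [ha']; ring
      j_mul_j := by
        ext <;> simp [hb']; ring
      i_mul_j := by ext <;> simp
      j_mul_i := by ext <;> simp [mul_comm] }
  refine ⟨AlgEquiv.ofAlgHom q.liftHom q'.liftHom ?_ ?_⟩
  · refine QuaternionAlgebra.hom_ext ?_ ?_
    · simp only [AlgHom.comp_apply, AlgHom.id_apply, QuaternionAlgebra.Basis.liftHom_apply, QuaternionAlgebra.Basis.lift,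
        QuaternionAlgebra.Basis.self]
      ext <;> simp [q, q', hc]
    · simp only [AlgHom.comp_apply, AlgHom.id_apply, QuaternionAlgebra.Basis.liftHom_apply, QuaternionAlgebra.Basis.lift,
        QuaternionAlgebra.Basis.self]
      ext <;> simp [q, q', hd]
  · refine QuaternionAlgebra.hom_ext ?_ ?_
    · simp only [AlgHom.comp_apply, AlgHom.id_apply, QuaternionAlgebra.Basis.liftHom_apply, QuaternionAlgebra.Basis.lift,
        QuaternionAlgebra.Basis.self]
      ext <;> simp [q, q', hc]
    · simp only [AlgHom.comp_apply, AlgHom.id_apply, QuaternionAlgebra.Basis.liftHom_apply, QuaternionAlgebra.Basis.lift,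
        QuaternionAlgebra.Basis.self]
      ext <;> simp [q, q', hd]

/-- **Swapping the parameters**: `ℍ[ℚ,a,b] ≃ₐ[ℚ] ℍ[ℚ,b,a]` (`i ↦ j'`, `j ↦ i'`, `k ↦ −k'`). [cite: VignerasLNM800, Ch. I §1 p. 1–2] -/
theorem nonempty_algEquiv_swap (a b : ℚ) : Nonempty (ℍ[ℚ,a,b] ≃ₐ[ℚ] ℍ[ℚ,b,a]) := by
  let q : QuaternionAlgebra.Basis ℍ[ℚ,b,a] a 0 b :=
    { i := ⟨0, 0, 1, 0⟩, j := ⟨0, 1, 0, 0⟩, k := ⟨0, 0, 0, -1⟩,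
      i_mul_i := by ext <;> simp
      j_mul_j := by ext <;> simp
      i_mul_j := by ext <;> simp
      j_mul_i := by ext <;> simp }
  let q' : QuaternionAlgebra.Basis ℍ[ℚ,a,b] b 0 a :=
    { i := ⟨0, 0, 1, 0⟩, j := ⟨0, 1, 0, 0⟩, k := ⟨0, 0, 0, -1⟩,
      i_mul_i := by ext <;> simp
      j_mul_j := by ext <;> simp
      i_mul_j := by ext <;> simp
      j_mul_i := by ext <;> simp }
  refine ⟨AlgEquiv.ofAlgHom q.liftHom q'.liftHom ?_ ?_⟩
  · refine QuaternionAlgebra.hom_ext ?_ ?_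
    · simp only [AlgHom.comp_apply, AlgHom.id_apply, QuaternionAlgebra.Basis.liftHom_apply, QuaternionAlgebra.Basis.lift,
        QuaternionAlgebra.Basis.self]
      ext <;> simp [q, q']
    · simp only [AlgHom.comp_apply, AlgHom.id_apply, QuaternionAlgebra.Basis.liftHom_apply, QuaternionAlgebra.Basis.lift,
        QuaternionAlgebra.Basis.self]
      ext <;> simp [q, q']
  · refine QuaternionAlgebra.hom_ext ?_ ?_
    · simp only [AlgHom.comp_apply, AlgHom.id_apply, QuaternionAlgebra.Basis.liftHom_apply, QuaternionAlgebra.Basis.lift,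
        QuaternionAlgebra.Basis.self]
      ext <;> simp [q, q']
    · simp only [AlgHom.comp_apply, AlgHom.id_apply, QuaternionAlgebra.Basis.liftHom_apply, QuaternionAlgebra.Basis.lift,
        QuaternionAlgebra.Basis.self]
      ext <;> simp [q, q']

/-- **A definite `ℍ[ℚ,a,b]` (`a, b < 0`) has no `ℚ`-algebra map to `M₂(ℝ)`**: the real extension `ψ : ℍ[ℝ,a,b] → M₂(ℝ)` of such a map is injective (the source is a division
algebra: `x x̄ = x₀² − a x₁² − b x₂² + ab x₃² > 0` for `x ≠ 0`) between real spaces of dimension `4`, hence surjective, so the rank-one matrix `E₁₁` would be a unit.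
[cite: VignerasLNM800, Ch. I §1 and Ch. III §3 (ramification at the real place)] [cite: ShimuraIATAF1971, §9.2 p. 246] -/
theorem false_of_algHom_real_of_neg {a b : ℤ} (ha : a < 0) (hb : b < 0) (g : ℍ[ℚ,(a : ℚ),(b : ℚ)] →ₐ[ℚ] Matrix (Fin 2) (Fin 2) ℝ) : False := by
  obtain ⟨ψ, -⟩ := exists_algHom_extension_real' g
  -- every non-zero element of `ℍ[ℝ,a,b]` is a unit
  have hunit : ∀ x : ℍ[ℝ,(a : ℝ),(b : ℝ)], x ≠ 0 → IsUnit x := by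
    intro x hx
    have ha' : (a : ℝ) < 0 := by exact_mod_cast ha
    have hb' : (b : ℝ) < 0 := by exact_mod_cast hb
    set N : ℝ := (x * star x).re with hN
    have hNval : N = x.re ^ 2 - (a : ℝ) * x.imI ^ 2 - (b : ℝ) * x.imJ ^ 2 + (a : ℝ) * (b : ℝ) * x.imK ^ 2 := by
      rw [hN]; simp; ring
    have hNpos : 0 < N := by
      rw [hNval]
      have h1 : 0 ≤ x.re ^ 2 := sq_nonneg _
      have h2 : 0 ≤ -(a : ℝ) * x.imI ^ 2 := mul_nonneg (by linarith) (sq_nonneg _)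
      have h3 : 0 ≤ -(b : ℝ) * x.imJ ^ 2 := mul_nonneg (by linarith) (sq_nonneg _)
      have h4 : 0 ≤ (a : ℝ) * (b : ℝ) * x.imK ^ 2 := mul_nonneg (by nlinarith) (sq_nonneg _)
      -- not all coordinates vanish
      by_contra hle
      push Not at hle
      have e1 : x.re ^ 2 = 0 := by nlinarith
      have e2 : -(a : ℝ) * x.imI ^ 2 = 0 := by nlinarith
      have e3 : -(b : ℝ) * x.imJ ^ 2 = 0 := by nlinarith
      have e4 : (a : ℝ) * (b : ℝ) * x.imK ^ 2 = 0 := by nlinarith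
      have f1 : x.re = 0 := by simpa using e1
      have f2 : x.imI = 0 := by
        rcases mul_eq_zero.mp e2 with h | h
        · exact absurd h (by linarith)
        · simpa using h
      have f3 : x.imJ = 0 := by
        rcases mul_eq_zero.mp e3 with h | h
        · exact absurd h (by linarith)
        · simpa using h
      have f4 : x.imK = 0 := by
        rcases mul_eq_zero.mp e4 with h | h
        · exact absurd h (by nlinarith)
        · simpa using h
      exact hx (QuaternionAlgebra.ext f1 f2 f3 f4)
    have hmul : x * star x = ((N : ℝ) : ℍ[ℝ,(a : ℝ),(b : ℝ)]) := by
      rw [hN]; exact QuaternionAlgebra.mul_star_eq_coe x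
    have hmul' : star x * x = ((N : ℝ) : ℍ[ℝ,(a : ℝ),(b : ℝ)]) := by
      rw [star_comm_self' x, hmul]
    refine isUnit_iff_exists.mpr ⟨N⁻¹ • star x, ?_, ?_⟩
    · rw [mul_smul_comm, hmul, QuaternionAlgebra.smul_coe, inv_mul_cancel₀ hNpos.ne', QuaternionAlgebra.coe_one]
    · rw [smul_mul_assoc, hmul', QuaternionAlgebra.smul_coe, inv_mul_cancel₀ hNpos.ne', QuaternionAlgebra.coe_one]
  -- `ψ` is injective, hence surjective (both sides have real dimension `4`)
  have hinj : Function.Injective ψ := by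
    refine (injective_iff_map_eq_zero ψ).mpr fun x hx => ?_
    by_contra hne
    have hu := (hunit x hne).map ψ
    rw [hx] at hu
    exact not_isUnit_zero hu
  have hdim : Module.finrank ℝ ℍ[ℝ,(a : ℝ),(b : ℝ)] = Module.finrank ℝ (Matrix (Fin 2) (Fin 2) ℝ) := by
    rw [QuaternionAlgebra.finrank_eq_four, Module.finrank_matrix]
    simp
  have hsurj : Function.Surjective ψ :=
    (LinearMap.injective_iff_surjective_of_finrank_eq_finrank hdim (f := ψ.toLinearMap)).mp hinj
  -- the rank-one matrix `E₁₁` is not a unit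
  set E : Matrix (Fin 2) (Fin 2) ℝ := Matrix.of ![![1, 0], ![0, 0]] with hE
  obtain ⟨x, hx⟩ := hsurj E
  have hx0 : x ≠ 0 := by
    rintro rfl
    have h1 : E 0 0 = 0 := by rw [← hx, map_zero]; rfl
    rw [hE] at h1
    simp at h1
  have hEu : IsUnit E := hx ▸ (hunit x hx0).map ψ
  rw [Matrix.isUnit_iff_isUnit_det, Matrix.det_fin_two, hE] at hEu
  simp at hEu

/-- **A quaternion algebra over `ℚ` with a `ℚ`-algebra map to `M₂(ℝ)` is `ℍ[ℚ,a,b]` with INTEGERS `a ≠ 0 < b`** (standard basis, tree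
`IsQuaternionAlgebra.exists_algEquiv_quaternionAlgebra`; clear denominators by squares; not both parameters negative by `false_of_algHom_real_of_neg`; swap if needed).
[cite: VignerasLNM800, Ch. I §1 and Ch. III §3] [cite: ShimuraIATAF1971, §9.2 p. 246 («B is either a division algebra, or isomorphic to M₂(Q)»)] -/
theorem exists_int_algEquiv_of_algHom_real {B : Type*} [Ring B] [Algebra ℚ B] [IsQuaternionAlgebra ℚ B]
    (ι : B →ₐ[ℚ] Matrix (Fin 2) (Fin 2) ℝ) :
    ∃ a b : ℤ, a ≠ 0 ∧ 0 < b ∧ Nonempty (B ≃ₐ[ℚ] ℍ[ℚ,(a : ℚ),(b : ℚ)]) := by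
  obtain ⟨a₀, b₀, ha₀, hb₀, ⟨e₀⟩⟩ := IsQuaternionAlgebra.exists_algEquiv_quaternionAlgebra ℚ B
  -- integers `a₁ = a₀ · den(a₀)² = num(a₀) · den(a₀)`, `b₁` likewise
  set a₁ : ℤ := a₀.num * a₀.den with ha₁
  set b₁ : ℤ := b₀.num * b₀.den with hb₁
  have hden_a : (a₀.den : ℚ) ≠ 0 := by exact_mod_cast a₀.den_nz
  have hden_b : (b₀.den : ℚ) ≠ 0 := by exact_mod_cast b₀.den_nz
  have ha₁' : (a₁ : ℚ) = a₀ * (a₀.den : ℚ) ^ 2 := by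
    rw [ha₁, Int.cast_mul, Int.cast_natCast, sq, ← mul_assoc, Rat.mul_den_eq_num]
  have hb₁' : (b₁ : ℚ) = b₀ * (b₀.den : ℚ) ^ 2 := by
    rw [hb₁, Int.cast_mul, Int.cast_natCast, sq, ← mul_assoc, Rat.mul_den_eq_num]
  have ha₁0 : a₁ ≠ 0 := by
    rw [ha₁]; exact mul_ne_zero (Rat.num_ne_zero.mpr ha₀) (by exact_mod_cast a₀.den_nz)
  have hb₁0 : b₁ ≠ 0 := by
    rw [hb₁]; exact mul_ne_zero (Rat.num_ne_zero.mpr hb₀) (by exact_mod_cast b₀.den_nz)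
  obtain ⟨e₁⟩ := nonempty_algEquiv_rescale a₀ b₀ (a₁ : ℚ) (b₁ : ℚ) (a₀.den : ℚ) (b₀.den : ℚ) hden_a hden_b ha₁' hb₁'
  have e : B ≃ₐ[ℚ] ℍ[ℚ,(a₁ : ℚ),(b₁ : ℚ)] := e₀.trans e₁
  -- sign analysis
  rcases lt_or_gt_of_ne hb₁0 with hb₁neg | hb₁pos
  · rcases lt_or_gt_of_ne ha₁0 with ha₁neg | ha₁pos
    · exact (false_of_algHom_real_of_neg ha₁neg hb₁neg (ι.comp (e.symm : ℍ[ℚ,(a₁ : ℚ),(b₁ : ℚ)] →ₐ[ℚ] B))).elim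
    · obtain ⟨e₂⟩ := nonempty_algEquiv_swap (a₁ : ℚ) (b₁ : ℚ)
      exact ⟨b₁, a₁, hb₁0, ha₁pos, ⟨e.trans e₂⟩⟩
  · exact ⟨a₁, b₁, ha₁0, hb₁pos, ⟨e⟩⟩

end Parameters

/-! ## §3 `ι(O¹)` is finitely generated; clause (SIGᶜ)(i) holds as stated -/

section FinitelyGenerated

/-- The image of a finitely generated subgroup under a homomorphism is finitely generated. [folklore] -/
private theorem subgroupFG_map {G G' : Type*} [Group G] [Group G'] (f : G →* G') {H : Subgroup G} (hH : H.FG) : (H.map f).FG := by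
  classical
  obtain ⟨S, hS⟩ := hH
  refine ⟨S.image f, ?_⟩
  rw [Finset.coe_image, ← MonoidHom.map_closure, hS]

/-- **For an ARBITRARY order `O'` of `ℍ[ℚ,a,b]` (`a ≠ 0 < b`), `ρ(O'¹)` is finitely generated**: it is commensurable with Bergeron's `Γ_{a,b} = ρ(𝔬¹)`
(`commensurable_normOneUnits`, `map_toGL_unitGroup_eq_normOneUnits`), which is finitely generated (`fg_unitGroup`). [cite: Bergeron2016, §2.2 Thm. 2.3 (2) p. 36] -/
theorem fg_normOneUnits_rhoQ {a b : ℤ} (ha : a ≠ 0) (hb : 0 < b) {O' : Submodule ℤ ℍ[ℚ,(a : ℚ),(b : ℚ)]}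
    (hO' : Brandt.IsOrder ℍ[ℚ,(a : ℚ),(b : ℚ)] O') : (normOneUnits (rhoQ hb.le) hO').FG := by
  haveI : IsQuaternionAlgebra ℚ ℍ[ℚ,(a : ℚ),(b : ℚ)] :=
    QuaternionAlgebra.isQuaternionAlgebra_holds (by exact_mod_cast ha) (by exact_mod_cast hb.ne')
  have hinj : Function.Injective (rhoQ (a := a) hb.le) := fun x y hxy => by
    rw [rhoQ_apply, rhoQ_apply] at hxy
    exact castQ_injective a b (rho_injective a b ha hb hxy)
  have h𝔬 : (normOneUnits (rhoQ hb.le) (isOrder_orderSubmodule a b)).FG := by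
    rw [← map_toGL_unitGroup_eq_normOneUnits hb.le]
    exact subgroupFG_map _ (fg_unitGroup ha hb)
  exact subgroupFG_of_commensurable (commensurable_normOneUnits (rhoQ hb.le) hinj hO' (isOrder_orderSubmodule a b)) h𝔬

/-- **For ANY `ℚ`-algebra map `g : ℍ[ℚ,a,b] → M₂(ℝ)` (`a ≠ 0 < b`) and any order `O'`, `g(O'¹)` is finitely generated** (`g = h ρ h⁻¹`, Skolem–Noether).
[cite: Bergeron2016, §2.2 Thm. 2.3 (2) p. 36 and proof p. 37] [cite: Voight2021, §7.7 Main Thm. 7.7.1] -/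
theorem fg_normOneUnits_of_algHom {a b : ℤ} (ha : a ≠ 0) (hb : 0 < b) (g : ℍ[ℚ,(a : ℚ),(b : ℚ)] →ₐ[ℚ] Matrix (Fin 2) (Fin 2) ℝ)
    {O' : Submodule ℤ ℍ[ℚ,(a : ℚ),(b : ℚ)]} (hO' : Brandt.IsOrder ℍ[ℚ,(a : ℚ),(b : ℚ)] O') : (normOneUnits g hO').FG := by
  obtain ⟨h, hh⟩ := exists_units_forall_eq_conj' ha hb g
  rw [normOneUnits_eq_conjAct_smul h hh hO', Subgroup.pointwise_smul_def]
  exact subgroupFG_map _ (fg_normOneUnits_rhoQ ha hb hO')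

/-- **`ι(O¹)` IS FINITELY GENERATED** for every order `O` of every quaternion algebra `B` over `ℚ` and every `ℚ`-algebra map `ι : B → M₂(ℝ)` (injective automatically,
but not even needed here): transport to `ℍ[ℚ,a,b]`, `a ≠ 0 < b`. [cite: ShimuraIATAF1971, §9.2 p. 246 and Prop. 1.31] [cite: Bergeron2016, §2.2 Thm. 2.3 (2) p. 36, §2.2.3 Lemma 2.7 p. 41] -/
theorem fg_normOneUnits {B : Type*} [Ring B] [Algebra ℚ B] [IsQuaternionAlgebra ℚ B] (ι : B →ₐ[ℚ] Matrix (Fin 2) (Fin 2) ℝ)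
    {O : Submodule ℤ B} (hO : Brandt.IsOrder B O) : (normOneUnits ι hO).FG := by
  obtain ⟨a, b, ha, hb, ⟨e⟩⟩ := exists_int_algEquiv_of_algHom_real ι
  set g : ℍ[ℚ,(a : ℚ),(b : ℚ)] →ₐ[ℚ] Matrix (Fin 2) (Fin 2) ℝ := ι.comp (e.symm : ℍ[ℚ,(a : ℚ),(b : ℚ)] →ₐ[ℚ] B) with hg
  have hι : ι = g.comp (e : B →ₐ[ℚ] ℍ[ℚ,(a : ℚ),(b : ℚ)]) := by
    ext x
    simp [hg]
  have h1 : normOneUnits ι hO = normOneUnits (g.comp (e : B →ₐ[ℚ] ℍ[ℚ,(a : ℚ),(b : ℚ)])) hO := by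
    simp only [hι]
  rw [h1, normOneUnits_comp_algEquiv e g hO]
  exact fg_normOneUnits_of_algHom ha hb g _

/-- The same as a `Group.FG` instance-shaped statement. [cite: ShimuraIATAF1971, §9.2 p. 246 and Prop. 1.31] -/
theorem groupFG_normOneUnits {B : Type*} [Ring B] [Algebra ℚ B] [IsQuaternionAlgebra ℚ B] (ι : B →ₐ[ℚ] Matrix (Fin 2) (Fin 2) ℝ)
    {O : Submodule ℤ B} (hO : Brandt.IsOrder B O) : Group.FG (normOneUnits ι hO) :=
  (Group.fg_iff_subgroup_fg _).mpr (fg_normOneUnits ι hO)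

/-- **CLAUSE (SIGᶜ)(i) HOLDS AS STATED**: for every quaternion algebra `B` over `ℚ`, order `O`, and `ℚ`-algebra map `ι : B → M₂(ℝ)`, the additive parabolic-null maps
`ι(O¹) → ℤ` have a finite `ℤ`-basis — the first conjunct of `Literature.NumberTheory.Automorphic.parabolicCochain_free_and_modLift` at `(B, O, ι)`, verbatim, PROVED
(finite generation + `sigBasisClause_of_fg`). [cite: Iwaniec2002, Ch. 2 Prop. 2.3 and Prop. 2.6] [cite: ShimuraIATAF1971, §9.2 p. 246] -/
theorem sigBasisClause {B : Type*} [Ring B] [Algebra ℚ B] [IsQuaternionAlgebra ℚ B] (O : Submodule ℤ B) (hO : Brandt.IsOrder B O)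
    (ι : B →ₐ[ℚ] Matrix (Fin 2) (Fin 2) ℝ) :
    ∃ (r : ℕ) (e : Fin r → (normOneUnits ι hO → ℤ)),
      (∀ i, (∀ γ δ : normOneUnits ι hO, e i (γ * δ) = e i γ + e i δ) ∧
        (∀ γ : normOneUnits ι hO, (γ : GL (Fin 2) ℝ).IsParabolic → e i γ = 0)) ∧
      ∀ u : normOneUnits ι hO → ℤ,
        (∀ γ δ : normOneUnits ι hO, u (γ * δ) = u γ + u δ) →
        (∀ γ : normOneUnits ι hO, (γ : GL (Fin 2) ℝ).IsParabolic → u γ = 0) →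
        ∃! c : Fin r → ℤ, u = fun γ => ∑ i, c i * e i γ := by
  haveI := groupFG_normOneUnits ι hO
  exact sigBasisClause_of_fg ι hO

end FinitelyGenerated

end Summit.BirchSwinnertonDyer.BirchSwinnertonDyer.Theorems.CartanCover.PrintClauses

end
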